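import Summits.AtomisticToContinuum.HydrodynamicLimit.Theses.AntiMazurCoboundaries
import Literature.Analysis.FluidPDE.HardSphereAlexander

/-!
# `BoltzmannGreenKubo` without its orthogonality clause is FALSE (load-bearing analysis)

Negative knowledge for the crux `AntiMazurCoboundaries.BoltzmannGreenKubo` (stmt-AtomisticToContinuum-13985, the
dilute-corner Green–Kubo rung), from the standing disprover's `Cruxes/BoltzmannGreenKubo/Disproof.lean` §1:
`BoltzmannGreenKuboWithoutOrthogonal` is the crux VERBATIM with the hypothesis `g ⊥ span(1, v, |v|²)` (in `L²` of the
standard Gaussian) deleted, and it is FALSE — for `φ ≡ 1`, `g ≡ 1` the observable `F = Σᵢ φ(xᵢ) g(wᵢ) ≡ N + 1` is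
constant along EVERY hard-sphere flow, so the kinetic-window functional per particle is `N + 1` and
`s · (N + 1)` cannot stay within `η` of the fixed number `2 (∫φ²) · dirichletFormInv L g` for two consecutive `N`.
Hence ANY PROOF of the crux must use the orthogonality clause (Mazur's mechanism at its crudest: the projection of `F`
on the conserved particle number is a Drude weight). Flows instantiating `∀ Φ` come from Alexander's theorem
(`HardSphereFlow.nonempty_torus_holds`); the probability clause is the statement's own first conjunct.
refuter-cdisprove-stmt-AtomisticToContinuum-13985-0.
-/

noncomputable section

namespace Summit.AtomisticToContinuum.HydrodynamicLimit.Theorems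

open MeasureTheory
open Literature.Analysis.FluidPDE Literature.MathematicalPhysics.KineticTheory
open Literature.Analysis.UnboundedOperators

namespace BoltzmannGreenKuboOrthogonality

/-- `BoltzmannGreenKubo` with the orthogonality hypothesis `g ⊥ span(1, v, |v|²)` DELETED (everything else
verbatim, including the probability clause and the `let h`). -/
def BoltzmannGreenKuboWithoutOrthogonal : Prop :=
  ∀ (a θ : ℝ) (u₀ : Literature.MathematicalPhysics.KineticTheory.V3), 0 < a → 0 < θ → ∀ (φ : Literature.MathematicalPhysics.KineticTheory.T3 → ℝ) (g : Literature.MathematicalPhysics.KineticTheory.V3 → ℝ), Continuous φ → Continuous g → (∀ x, |φ x| ≤ 1) → (∃ K : ℝ, ∀ v, |g v| ≤ K) → ∀ η : ℝ, 0 < η → ∃ s₀ : ℝ, 0 < s₀ ∧ ∀ s : ℝ, s₀ ≤ s → ∃ σ₀ : ℝ, 0 < σ₀ ∧ ∀ σ : ℝ, 0 < σ → σ < σ₀ → (∀ (N : ℕ) (Φ : Literature.Analysis.FluidPDE.HardSphereFlow (Literature.Analysis.FluidPDE.Torus.geometry (Fin 3)) (Literature.MathematicalPhysics.KineticTheory.hsDiameter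 σ N) (N + 1)), MeasureTheory.IsProbabilityMeasure (Literature.MathematicalPhysics.KineticTheory.localGibbsLaw σ (fun _ => a) (fun _ => u₀) (fun _ => θ) N Φ)) ∧ ∃ N₀ : ℕ, ∀ N : ℕ, N₀ ≤ N → ∀ Φ : Literature.Analysis.FluidPDE.HardSphereFlow (Literature.Analysis.FluidPDE.Torus.geometry (Fin 3)) (Literature.MathematicalPhysics.KineticTheory.hsDiameter σ N) (N + 1), (let h : ℝ := s / (σ ^ 2 * Real.sqrt θ) * ((N + 1 : ℕ) : ℝ) ^ (-(1 / 3 : ℝ)); |s * ((∫⁻ z, ENNReal.ofReal ((h⁻¹ * ∫ r in (0 : ℝ)..h, ∑ i, φ (Φ.flow r z i).1 * g ((Real.sqrt θ)⁻¹ • ((Φ.flow r z i).2 - u₀))) ^ 2) ∂(Literature.MathematicalPhysics.KineticTheory.localGibbsLaw σ (fun _ => a) (fun _ => u₀) (fun _ => θ) N Φ)).toReal / (((N : ℝ)) + 1)) - 2 * (∫ x, φ x ^ 2) * Literature.Analysis.UnboundedOperators.dirichletFormInv (Literature.Analysis.UnboundedOperators.hardSphereLinearizedOp (E := Literature.MathematicalPhysics.KineticTheory.V3))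 g| ≤ η)

/-- The window functional of a CONSTANT observable: `(∫⁻ ofReal ((h⁻¹∫₀ʰ c dr)²) dμ).toReal = c²` for a
probability measure `μ` and `h ≠ 0` (no dynamics enters). [folklore] -/
theorem window_const_toReal {Ω : Type*} [MeasurableSpace Ω] (μ : Measure Ω)
    [IsProbabilityMeasure μ] {h : ℝ} (hh : h ≠ 0) (c : ℝ) :
    (∫⁻ _z, ENNReal.ofReal ((h⁻¹ * ∫ _r in (0:ℝ)..h, c) ^ 2) ∂μ).toReal = c ^ 2 := by
  simp [intervalIntegral.integral_const, inv_mul_cancel_left₀ hh, ENNReal.toReal_ofReal (sq_nonneg c)]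

end BoltzmannGreenKuboOrthogonality

open BoltzmannGreenKuboOrthogonality in
/-- **ANY PROOF MUST USE THE ORTHOGONALITY CLAUSE.** With `g ⊥ span(1,v,|v|²)` deleted the statement is
false: at `a = θ = 1`, `u₀ = 0`, `φ ≡ 1`, `g ≡ 1`, `η = 1` the observable is `F ≡ N + 1` along EVERY flow, the
window functional per particle is `N + 1`, and `|s(N+1) − C| ≤ 1` at two consecutive `N ≥ N₀` forces `s ≤ 2`,
against `s = max s₀ 3`. Flows instantiating `∀ Φ`: Alexander (`HardSphereFlow.nonempty_torus_holds`, diameter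
`≤ σ ≤ 1/4 < 1/2`); the probability clause is the statement's own first conjunct. Mazur's mechanism at its
crudest: the projection of `F` on the conserved particle number is a Drude weight. [folklore] -/
theorem boltzmannGreenKubo_false_without_orthogonal : ¬ BoltzmannGreenKuboWithoutOrthogonal := by
  intro h
  obtain ⟨s₀, hs₀, h2⟩ := h 1 1 0 one_pos one_pos (fun _ => 1) (fun _ => 1) continuous_const
    continuous_const (fun _ => by simp) ⟨1, fun _ => by simp⟩ 1 one_pos
  set s : ℝ := max s₀ 3 with hsdef
  have hs3 : (3 : ℝ) ≤ s := le_max_right _ _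
  have hspos : 0 < s := by linarith
  obtain ⟨σ₀, hσ₀, h3⟩ := h2 s (le_max_left _ _)
  set σ : ℝ := min (σ₀ / 2) (1 / 4) with hσdef
  have hσpos : 0 < σ := lt_min (by linarith) (by norm_num)
  have hσlt : σ < σ₀ := lt_of_le_of_lt (min_le_left _ _) (by linarith)
  obtain ⟨hprob, N₀, h4⟩ := h3 σ hσpos hσlt
  have key : ∀ N : ℕ, N₀ ≤ N → |s * ((N : ℝ) + 1) - 2 * (∫ x : T3, (1 : ℝ) ^ 2) *
      dirichletFormInv (hardSphereLinearizedOp (E := V3)) (fun _ => (1 : ℝ))| ≤ 1 := by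
    intro N hN
    have hεpos : 0 < hsDiameter σ N := hsDiameter_pos hσpos N
    have hεlt : hsDiameter σ N < 2⁻¹ := by
      have := hsDiameter_le hσpos.le N
      have hσle : σ ≤ 1 / 4 := min_le_right _ _
      linarith
    obtain ⟨Φ⟩ := HardSphereFlow.nonempty_torus_holds (d := Fin 3) hεpos hεlt (N + 1)
    haveI := hprob N Φ
    have k := h4 N hN Φ
    have hh : s / (σ ^ 2 * Real.sqrt 1) * ((N + 1 : ℕ) : ℝ) ^ (-(1 / 3 : ℝ)) ≠ 0 := by positivity
    dsimp only at k
    simp only [mul_one, Finset.sum_const, Finset.card_univ, Fintype.card_fin, nsmul_eq_mul] at k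
    rw [window_const_toReal _ hh] at k
    have e : ((N + 1 : ℕ) : ℝ) ^ 2 / ((N : ℝ) + 1) = (N : ℝ) + 1 := by
      push_cast
      rw [sq, mul_div_assoc, div_self (by positivity), mul_one]
    rw [e] at k
    exact k
  have k1 := key N₀ le_rfl
  have k2 := key (N₀ + 1) (Nat.le_succ _)
  push_cast at k2
  rw [abs_le] at k1 k2
  nlinarith [k1.1, k1.2, k2.1, k2.2]


end Summit.AtomisticToContinuum.HydrodynamicLimit.Theorems

end
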